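import Literature.NumberTheory.QuadraticFields.SqrtNegTwoFieldPrimes
import Literature.NumberTheory.Automorphic.GaloisActionPlaces
import HarnessLib

set_option linter.dupNamespace false -- `Summit.BirchSwinnertonDyer.BirchSwinnertonDyer.Theorems.…` (summit = sub, D-0017)
set_option autoImplicit false

/-!
# Crux `HeegnerTwistCouplingInSupply` (stmt-BirchSwinnertonDyer-21381) — programme «TWISTED 3-ISOGENY DESCENT», file P6c₁:
# places of prime elements and CLASS NUMBER ONE ⟹ "valuations divisible by `3` ⟹ unit × cube"

Route `BiquadraticEisensteinDescent` (cell `pub/bsd-wall`, width seat `bsd-wall-cm-bed-w4` g32; `--supports` 21381, helper). Generic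
arithmetic inputs of the sharp `φ̂`-box (file P6c₂ `…SylvesterTwistPhiHatBox`): for a number field `K`,

* §0 `exists_eq_cube_of_zpow_eq_cube` (`x^A` a cube, `3 ∤ A` ⟹ `x` a cube, Bézout), `norm_mk` (`N(a + b√−2) = a² + 2b²`);
* §1 the place `(π)` of a prime element `π ∈ 𝓞 K`: `v_{(π)}(π) = exp(−1)`, `w(π) = 1` off `(π)`, and `π ∈ w ⟹ w = (π)`;
* §2 ★ `exists_unit_mul_cube_of_forall_dvd_intValuation` / `exists_unit_mul_cube_of_forall_dvd_valuation` — if `𝓞 K` is principal, an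
  element all of whose valuations are divisible by `3` is `ε z³` with `ε ∈ 𝓞_Kˣ` (induction on the norm `N((r))`: a prime `q ∣ r` has
  `q³ ∣ r` by `intValuation_le_pow_iff_dvd`). (The tree's `Literature…ValuationCubeClassGroup` states the class-group form but has no farm
  build at present, hence this self-contained class-number-one version.)

HONEST FRAMING: elementary support lemmas; the crux (residual C⁺), its stubs, `hDescU` and BSD are untouched. THEOREMS ONLY (no `def`, no named
fact, no sorry). Supports stmt-BirchSwinnertonDyer-21381.
[cite: Marcus2018, Ch. 3 Thm. 16 and Thm. 22; Ch. 5 Exercise 9 (m = −2)] [cite: CasselsFrohlichANT1967, Ch. VII §1.1]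
-/

noncomputable section

open scoped Classical WithZero

namespace Summit.BirchSwinnertonDyer.BirchSwinnertonDyer.Theorems.SylvesterTwistDescent

open IsDedekindDomain IsDedekindDomain.HeightOneSpectrum NumberField
open WithZero (log exp)

variable {K : Type} [Field K] [NumberField K]

/-! ## §0 Two algebraic helpers -/

/-- In a field: if `x ^ A` is a cube and `3 ∤ A` then `x` is a cube (Bézout). [folklore] -/
theorem exists_eq_cube_of_zpow_eq_cube {F : Type*} [Field F] {x t : F} (hx : x ≠ 0) {A : ℤ} (hA : ¬ (3 : ℤ) ∣ A)
    (h : x ^ A = t ^ 3) : ∃ s : F, x = s ^ 3 := by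
  obtain ⟨m, n, hmn⟩ := (Prime.coprime_iff_not_dvd Int.prime_three).mpr hA
  refine ⟨x ^ m * t ^ n, ?_⟩
  have h3 : ∀ y : F, y ^ (3 : ℕ) = y ^ (3 : ℤ) := fun y => (zpow_ofNat y 3).symm
  calc x = x ^ (m * 3 + n * A) := by rw [hmn, zpow_one]
    _ = (x ^ m) ^ (3 : ℤ) * (x ^ A) ^ n := by rw [zpow_add₀ hx, zpow_mul, mul_comm n A, zpow_mul]
    _ = (x ^ m) ^ (3 : ℤ) * (t ^ n) ^ (3 : ℤ) := by rw [h, h3, ← zpow_mul, ← zpow_mul, ← zpow_mul, mul_comm (3 : ℤ) n]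
    _ = (x ^ m * t ^ n) ^ 3 := by rw [mul_pow, h3, h3]

/-- `N(a + b√−2) = a² + 2b²`. [cite: Marcus2018, Ch. 5 Exercise 9 (m = −2)] -/
theorem norm_mk (a b : ℤ) : (⟨a, b⟩ : ℤ√(-2)).norm = a ^ 2 + 2 * b ^ 2 := by
  simp only [Zsqrtd.norm_def]; ring

/-! ## §1 Places of prime elements: `v_{(π)}(π) = exp(−1)`, `w(π) = 1` off `(π)` -/

omit [NumberField K] in
/-- The place of a prime element `π` of `𝓞 K`: `v.asIdeal = (π)`. [cite: Marcus2018, Ch. 3 Thm. 16] -/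
theorem exists_place_of_prime {π : 𝓞 K} (hπ : Prime π) : ∃ v : HeightOneSpectrum (𝓞 K), v.asIdeal = Ideal.span {π} :=
  ⟨⟨Ideal.span {π}, (Ideal.span_singleton_prime hπ.ne_zero).mpr hπ, by rw [Ne, Ideal.span_singleton_eq_bot]; exact hπ.ne_zero⟩,
    rfl⟩

/-- At the place `(π)`: `v(π) = exp(−1)`. [cite: CasselsFrohlichANT1967, Ch. VII §1.1] -/
theorem valuation_self_of_span {π : 𝓞 K} (hπ : Prime π) {v : HeightOneSpectrum (𝓞 K)} (hv : v.asIdeal = Ideal.span {π}) :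
    v.valuation K (π : K) = exp (-1 : ℤ) := by
  rw [RingOfIntegers.coe_eq_algebraMap, valuation_of_algebraMap]
  exact intValuation_singleton v hπ.ne_zero hv

/-- A place containing the prime element `π` is the place `(π)`. [cite: Marcus2018, Ch. 3 Thm. 16] -/
theorem eq_of_mem_of_span {π : 𝓞 K} (hπ : Prime π) {v w : HeightOneSpectrum (𝓞 K)} (hv : v.asIdeal = Ideal.span {π})
    (hw : π ∈ w.asIdeal) : w = v := by
  have hP : (Ideal.span {π}).IsPrime := (Ideal.span_singleton_prime hπ.ne_zero).mpr hπ
  have hmax : (Ideal.span {π}).IsMaximal := hP.isMaximal (by rw [Ne, Ideal.span_singleton_eq_bot]; exact hπ.ne_zero)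
  have hle : Ideal.span {π} ≤ w.asIdeal := by rw [Ideal.span_singleton_le_iff_mem]; exact hw
  exact HeightOneSpectrum.ext ((hmax.eq_of_le w.isPrime.ne_top hle).symm.trans hv.symm)

/-- Off the place `(π)`: `w(π) = 1`. [cite: CasselsFrohlichANT1967, Ch. VII §1.1] -/
theorem valuation_eq_one_of_ne {π : 𝓞 K} (hπ : Prime π) {v w : HeightOneSpectrum (𝓞 K)} (hv : v.asIdeal = Ideal.span {π})
    (hw : w ≠ v) : w.valuation K (π : K) = 1 := by
  rw [RingOfIntegers.coe_eq_algebraMap, valuation_eq_one_iff_notMem]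
  exact fun hmem => hw (eq_of_mem_of_span hπ hv hmem)

/-! ## §2 Class number one: valuations divisible by `3` ⟹ unit times a cube -/

/-- **In a principal ring of integers, a non-zero `r` all of whose valuations are divisible by `3` is a unit times a cube**
(induction on `N(r)`: a prime `q ∣ r` has `q³ ∣ r`). [cite: Marcus2018, Ch. 3 Thm. 16 and Thm. 22] -/
theorem exists_unit_mul_cube_of_forall_dvd_intValuation [IsPrincipalIdealRing (𝓞 K)] :
    ∀ (n : ℕ) (r : 𝓞 K), Ideal.absNorm (Ideal.span {r}) = n → r ≠ 0 →
      (∀ v : HeightOneSpectrum (𝓞 K), (3 : ℤ) ∣ log (v.intValuation r)) → ∃ (ε : (𝓞 K)ˣ) (γ : 𝓞 K), r = ε * γ ^ 3 := by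
  intro n
  refine Nat.strong_induction_on n ?_
  intro n ih r hn hr h
  by_cases hunit : IsUnit r
  · exact ⟨hunit.unit, 1, by simp⟩
  -- a prime `q` with `r ∈ (q)`
  obtain ⟨M, hMmax, hrM⟩ := Ideal.exists_le_maximal (Ideal.span {r}) (by rwa [Ne, Ideal.span_singleton_eq_top])
  have hMbot : M ≠ ⊥ := by
    intro hM
    rw [hM, le_bot_iff, Ideal.span_singleton_eq_bot] at hrM
    exact hr hrM
  obtain ⟨v, hvM⟩ : ∃ v : HeightOneSpectrum (𝓞 K), v.asIdeal = M := ⟨⟨M, hMmax.isPrime, hMbot⟩, rfl⟩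
  obtain ⟨q, hq⟩ := (IsPrincipalIdealRing.principal M).principal
  have hqM : v.asIdeal = Ideal.span {q} := by rw [hvM]; exact hq
  have hq0 : q ≠ 0 := by
    rintro rfl
    apply hMbot
    rw [hq]; simp
  have hqpr : Prime q := (Ideal.span_singleton_prime hq0).mp (by rw [← hqM]; exact v.isPrime)
  -- `v(r) ≤ exp(−3)`, so `q³ ∣ r`
  have hrv : r ∈ v.asIdeal := by rw [hvM]; exact hrM (Ideal.mem_span_singleton_self r)
  have hlt : v.intValuation r < 1 := (v.intValuation_lt_one_iff_mem r).mpr hrv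
  have hV0 : v.intValuation r ≠ 0 := v.intValuation_ne_zero r hr
  obtain ⟨k, hk⟩ := h v
  have hk1 : k ≤ -1 := by
    have : log (v.intValuation r) < 0 := by
      rw [← WithZero.exp_lt_exp, WithZero.exp_log hV0, WithZero.exp_zero]; exact hlt
    omega
  have hle : v.intValuation r ≤ exp (-((3 : ℕ) : ℤ)) := by
    rw [← WithZero.exp_log hV0, WithZero.exp_le_exp, hk]; push_cast; omega
  have hdvd : q ^ 3 ∣ r := by
    have := (v.intValuation_le_pow_iff_dvd r 3).mp hle
    rwa [hqM, Ideal.span_singleton_pow, Ideal.dvd_span_singleton, Ideal.mem_span_singleton] at this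
  obtain ⟨r₁, hr₁⟩ := hdvd
  have hr₁0 : r₁ ≠ 0 := by
    rintro rfl
    rw [mul_zero] at hr₁
    exact hr hr₁
  -- the norm drops
  have hnormlt : Ideal.absNorm (Ideal.span {r₁}) < n := by
    have hmul : Ideal.absNorm (Ideal.span {r}) = Ideal.absNorm (Ideal.span {q ^ 3}) * Ideal.absNorm (Ideal.span {r₁}) := by
      rw [hr₁, ← Ideal.span_singleton_mul_span_singleton, map_mul]
    have h1 : 1 < Ideal.absNorm (Ideal.span {q ^ 3}) := by
      have hne1 : Ideal.absNorm (Ideal.span {q ^ 3}) ≠ 1 := by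
        rw [Ne, Ideal.absNorm_eq_one_iff, Ideal.span_singleton_eq_top]
        exact fun hu => hqpr.not_unit ((isUnit_pow_iff three_ne_zero).mp hu)
      have hne0 : Ideal.absNorm (Ideal.span {q ^ 3}) ≠ 0 := by
        rw [Ne, Ideal.absNorm_eq_zero_iff, Ideal.span_singleton_eq_bot]; exact pow_ne_zero 3 hq0
      omega
    have h2 : 0 < Ideal.absNorm (Ideal.span {r₁}) := by
      rw [pos_iff_ne_zero, Ne, Ideal.absNorm_eq_zero_iff, Ideal.span_singleton_eq_bot]; exact hr₁0
    rw [← hn, hmul]; nlinarith [mul_lt_mul_of_pos_right h1 h2]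
  -- the valuations of `r₁` are again divisible by `3`
  have h₁ : ∀ w : HeightOneSpectrum (𝓞 K), (3 : ℤ) ∣ log (w.intValuation r₁) := by
    intro w
    have hw := h w
    rw [hr₁, map_mul, map_pow, WithZero.log_mul (pow_ne_zero 3 (w.intValuation_ne_zero q hq0)) (w.intValuation_ne_zero r₁ hr₁0),
      WithZero.log_pow, nsmul_eq_mul] at hw
    push_cast at hw
    exact (dvd_add_right (dvd_mul_right 3 _)).mp hw
  obtain ⟨ε, γ, hεγ⟩ := ih _ hnormlt r₁ rfl hr₁0 h₁
  exact ⟨ε, q * γ, by rw [hr₁, hεγ]; ring⟩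

/-- **Class number one, field version**: `u ∈ Kˣ` with all valuations divisible by `3` is `ε z³`, `ε ∈ 𝓞_Kˣ`.
[cite: Marcus2018, Ch. 3 Thm. 16 and Thm. 22] -/
theorem exists_unit_mul_cube_of_forall_dvd_valuation [IsPrincipalIdealRing (𝓞 K)] {u : K} (hu : u ≠ 0)
    (h : ∀ v : HeightOneSpectrum (𝓞 K), (3 : ℤ) ∣ log (v.valuation K u)) :
    ∃ (ε : (𝓞 K)ˣ) (z : K), u = algebraMap (𝓞 K) K ε * z ^ 3 := by
  obtain ⟨α, β, hβ, hαβ⟩ := IsFractionRing.div_surjective (A := 𝓞 K) u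
  have hβ0 : β ≠ 0 := nonZeroDivisors.ne_zero hβ
  have hβK : algebraMap (𝓞 K) K β ≠ 0 := RingOfIntegers.coe_ne_zero_iff.mpr hβ0
  have hα0 : α ≠ 0 := by
    rintro rfl
    apply hu
    rw [← hαβ, map_zero, zero_div]
  obtain ⟨r, hr⟩ : ∃ r : 𝓞 K, r = α * β ^ 2 := ⟨_, rfl⟩
  have hr0 : r ≠ 0 := by rw [hr]; exact mul_ne_zero hα0 (pow_ne_zero 2 hβ0)
  have hur : algebraMap (𝓞 K) K r = u * algebraMap (𝓞 K) K β ^ 3 := by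
    rw [hr, map_mul, map_pow, ← hαβ, div_mul_eq_mul_div, eq_comm, div_eq_iff hβK]; ring
  have hval : ∀ v : HeightOneSpectrum (𝓞 K), (3 : ℤ) ∣ log (v.intValuation r) := by
    intro v
    have h1 : v.valuation K u ≠ 0 := (Valuation.ne_zero_iff _).mpr hu
    have h2 : v.valuation K (algebraMap (𝓞 K) K β) ≠ 0 := (Valuation.ne_zero_iff _).mpr hβK
    have e : v.intValuation r = v.valuation K (algebraMap (𝓞 K) K r) := (valuation_of_algebraMap v r).symm
    rw [e, hur, map_mul, map_pow, WithZero.log_mul h1 (pow_ne_zero 3 h2), WithZero.log_pow, nsmul_eq_mul]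
    push_cast
    exact dvd_add (h v) (dvd_mul_right 3 _)
  obtain ⟨ε, γ, hεγ⟩ := exists_unit_mul_cube_of_forall_dvd_intValuation (K := K) _ r rfl hr0 hval
  refine ⟨ε, algebraMap (𝓞 K) K γ / algebraMap (𝓞 K) K β, ?_⟩
  rw [div_pow, mul_div_assoc', eq_div_iff (pow_ne_zero 3 hβK), ← hur, hεγ, map_mul, map_pow]

end Summit.BirchSwinnertonDyer.BirchSwinnertonDyer.Theorems.SylvesterTwistDescent

end
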